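import Literature.NumberTheory.LFunctions.MauduitRivatTypeIIFourier
import Mathlib.NumberTheory.Harmonic.Bounds
import HarnessLib

/-!
# Counting products `mn` with prescribed middle digits, sharp form (Mauduit–Rivat 2015, Lemma 9 by exponential sums; proved)

Everything in this file is PROVED. The tree's `MauduitRivatTypeIITruncation.card_box_midDigit_mem_le`
counts the pairs `(m, n)` in a box whose product has its middle digits `r_{μ₀,μ₂}(mn + c)` in a set
`B` by a direct counting (`MauduitRivatWindowCount.card_window_le`); the resulting bound contains a
term `#B · M · k^{μ₀}` (the incomplete period of `n`), which is only acceptable when the `n`-range is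
longer than the period `k^{μ₂}` — false on and above the diagonal `M ≈ N`, where C. Mauduit, J. Rivat,
*Prime numbers along Rudin–Shapiro sequences*, J. Eur. Math. Soc. 17 (2015) nevertheless need Lemma 9
(and where the type-II estimate for the Möbius function has to be used with the Cauchy–Schwarz variable
being the LONGER one). Here we prove the bound of the printed proof of Lemma 9 (pp. 2603–2605: detect
the block of `K/L` residues by a trigonometric majorant, expand, sum the geometric sums over `m` by
Lemma 4), in the discrete form of the tree: the indicator of the block `u` is majorised by twice the
Fejér-smoothed indicator `smoothInd K L K u` (`MauduitRivatTypeIISmoothing.lean`) away from the block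
boundary, the boundary layer (width `1`) being counted by `card_box_gridDist_le`:

* `indicator_block_le_smoothInd` — `𝟙[⌊(x mod K)/L⌋ ∈ B] ≤ 2 ∑_{u∈B} A_u(x) + 𝟙[T(x) ≤ 1]`;
* `norm_sum_box_fourierChar_le` — `|∑_{m,n} e(h(mn+c)/K)| ≤ (M₁/K + 1)(2 gcd(h,K) N + K(1 + log K))`
  (geometric sum in `n`, Lemma 4 over the periods of `m`);
* `sum_Ico_gcd_div_le`, `sum_Ico_geomBound_gcd_le` — `∑_{0<h<K} gcd(h,K)/h ≤ τ(K)(1 + log K)` and the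
  resulting `∑_{0<h<K} min(L, 1/(2‖h/K‖)) gcd(h,K) ≤ K τ(K)(1 + log K)`;
* **`card_box_block_mem_le_sharp`** — for `K = K'L`, `B ⊆ [0, K')`, `M₀ ≥ 1`:
  `#{(m,n) ∈ [M₀,M₁)×[N₀,N₀+N) : ⌊((mn+c) mod K)/L⌋ ∈ B} ≤ 2 #B (L/K)(M₁−M₀)N`
  `+ 4 #B (M₁/K + 1)(1 + log K)(2Nτ(K) + 2L + K(1 + log K)) + 2(M₁−M₀)(N/L + 3) + 8τ(L)M₁N/L`
  (main term twice the expected count, no loss in the incomplete period), and its base-`k` instance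
  **`card_box_midDigit_mem_le_sharp`** for `r_{μ₀,μ₂}` (`K = k^{μ₂}`, `L = k^{μ₀}`).

## References
* C. Mauduit, J. Rivat, J. Eur. Math. Soc. 17 (2015) 2595–2642, Lemma 9 and its proof (pp. 2603–2605),
  Lemma 4. [MauduitRivat2015]
-/

noncomputable section

open Finset Complex

open scoped FourierTransform ComplexConjugate

namespace Literature.NumberTheory.LFunctions.MauduitRivat

open Literature.NumberTheory.Sieve.Vinogradov (geomBound geomBound_nonneg geomBound_neg geomBound_le
  geomBound_zero geomBound_le_inv distInt distInt_nonneg)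
open Literature.NumberTheory.LFunctions.MoebiusWalsh (sum_range_geomBound_div_add_le)
open Literature.NumberTheory.LFunctions.VinogradovZetaSum (geomBound_add_int)

/-! ## The pointwise majorant -/

/-- **The block indicator is majorised by the smoothed indicators away from the block boundary**:
with `H = K` in `smoothInd`, `𝟙[⌊(x mod K)/L⌋ ∈ B] ≤ 2 ∑_{u ∈ B} A_u(x) + 𝟙[T(x) ≤ 1]`
(`one_sub_smoothInd_le`: `1 − A_{u(x)}(x) ≤ 1/T(x) ≤ 1/2` when `T(x) ≥ 2`).
[cite: MauduitRivat2015, Lemma 9 (proof: χ ≤ A + B)] -/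
theorem indicator_block_le_smoothInd {K K' L : ℕ} (hK : K = K' * L) (hL : 0 < L) (hKpos : 0 < K)
    (B : Finset ℕ) (x : ℕ) :
    (if x % K / L ∈ B then (1 : ℝ) else 0) ≤
      2 * ∑ u ∈ B, smoothInd K L K u x + (if gridDist L x ≤ 1 then (1 : ℝ) else 0) := by
  have hS : 0 ≤ ∑ u ∈ B, smoothInd K L K u x := sum_nonneg fun u _ => smoothInd_nonneg _ _ _ _ _
  by_cases hT : gridDist L x ≤ 1
  · rw [if_pos hT]
    split_ifs <;> linarith
  rw [if_neg hT, add_zero]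
  split_ifs with hx
  · have h2 : (2 : ℝ) ≤ gridDist L x := by
      have : 2 ≤ gridDist L x := by omega
      exact_mod_cast this
    have h1 := one_sub_smoothInd_le hK hL hKpos le_rfl x
    have hmin : min 1 ((K : ℝ) / (K * gridDist L x)) ≤ 1 / 2 := by
      refine (min_le_right _ _).trans ?_
      have hKR : (0 : ℝ) < K := by exact_mod_cast hKpos
      rw [← div_div, div_self hKR.ne']
      exact one_div_le_one_div_of_le (by norm_num) h2
    have hsingle : smoothInd K L K (x % K / L) x ≤ ∑ u ∈ B, smoothInd K L K u x :=
      single_le_sum (fun u _ => smoothInd_nonneg K L K u x) hx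
    linarith
  · linarith

/-! ## Sums over `(−K, K)` of even functions -/

/-- `∑_{h ∈ (−K, K)} F(h) = F(0) + ∑_{0<h<K} (F(h) + F(−h))` (`K ≥ 1`). [folklore] -/
theorem sum_Ioo_neg_eq (F : ℤ → ℝ) {K : ℕ} (hK : 1 ≤ K) :
    ∑ h ∈ Ioo (-(K : ℤ)) K, F h = F 0 + ∑ h ∈ Ico 1 K, (F (h : ℤ) + F (-(h : ℤ))) := by
  induction K, hK using Nat.le_induction with
  | base =>
    have h : Ioo (-((1 : ℕ) : ℤ)) ((1 : ℕ) : ℤ) = {0} := by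
      ext h; simp only [mem_Ioo, mem_singleton, Nat.cast_one]; omega
    rw [h, sum_singleton]
    simp
  | succ K hK ih =>
    have hnot1 : (K : ℤ) ∉ Ioo (-(K : ℤ)) K := by simp
    have hnot2 : (-(K : ℤ)) ∉ insert (K : ℤ) (Ioo (-(K : ℤ)) K) := by
      simp only [mem_insert, mem_Ioo, not_or]
      constructor <;> omega
    have hset : Ioo (-((K + 1 : ℕ) : ℤ)) ((K + 1 : ℕ) : ℤ) =
        insert (-(K : ℤ)) (insert (K : ℤ) (Ioo (-(K : ℤ)) K)) := by
      ext h
      simp only [mem_Ioo, mem_insert, Nat.cast_add, Nat.cast_one]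
      omega
    rw [hset, sum_insert hnot2, sum_insert hnot1, ih, sum_Ico_succ_top hK]
    ring

/-! ## Exponential sums over the box -/

/-- Geometric sum over `n ∈ [N₀, N₀ + N)`: `‖∑_n e(n y)‖ ≤ min(N, 1/(2‖y‖))`. [folklore] -/
theorem norm_sum_Ico_fourierChar_le_geomBound (N₀ N : ℕ) (y : ℝ) :
    ‖∑ n ∈ Ico N₀ (N₀ + N), (𝐞 ((n : ℝ) * y) : ℂ)‖ ≤ geomBound N y := by
  have e : ∑ n ∈ Ico N₀ (N₀ + N), (𝐞 ((n : ℝ) * y) : ℂ) =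
      (𝐞 ((N₀ : ℝ) * y) : ℂ) * ∑ a ∈ range N, (𝐞 ((a : ℝ) * y) : ℂ) := by
    rw [sum_Ico_eq_sum_range, Nat.add_sub_cancel_left, mul_sum]
    refine sum_congr rfl fun a _ => ?_
    rw [coe_fourierChar_mul]
    push_cast
    rw [add_mul]
  rw [e, norm_mul, norm_fourierChar, one_mul]
  exact norm_sum_range_fourierChar_le_geomBound y le_rfl

/-- Summing the majorant over `m`: `∑_{M₀≤m<M₁} min(N, 1/(2‖hm/K‖)) ≤ (M₁/K + 1)(2 gcd(h,K) N + K(1 + log K))`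
(complete the `m`-range to `M₁/K + 1` periods and apply Lemma 4 to each). [cite: MauduitRivat2015, Lemma 4] -/
theorem sum_Ico_geomBound_mul_div_le {K : ℕ} (hK : 0 < K) (h M₀ M₁ N : ℕ) :
    ∑ m ∈ Ico M₀ M₁, geomBound N ((h : ℝ) * m / K) ≤
      ((M₁ / K + 1 : ℕ) : ℝ) * (2 * (Nat.gcd h K) * N + K * (1 + Real.log K)) := by
  set P := M₁ / K + 1 with hP
  have hper : ∀ m : ℕ, geomBound N ((h : ℝ) * ((m + K : ℕ) : ℝ) / K) = geomBound N ((h : ℝ) * m / K) := by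
    intro m
    have hKR : (K : ℝ) ≠ 0 := by exact_mod_cast hK.ne'
    have e : (h : ℝ) * ((m + K : ℕ) : ℝ) / K = (h : ℝ) * m / K + ((h : ℤ) : ℝ) := by
      push_cast; field_simp
    rw [e, geomBound_add_int]
  have hsub : Ico M₀ M₁ ⊆ range (K * P) := by
    intro m hm
    rw [mem_Ico] at hm
    rw [mem_range, hP, Nat.mul_succ]
    have := Nat.lt_mul_div_succ M₁ hK
    have h2 : K * (M₁ / K + 1) = K * (M₁ / K) + K := by ring
    omega
  calc ∑ m ∈ Ico M₀ M₁, geomBound N ((h : ℝ) * m / K)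
      ≤ ∑ m ∈ range (K * P), geomBound N ((h : ℝ) * m / K) :=
        sum_le_sum_of_subset_of_nonneg hsub fun m _ _ => geomBound_nonneg (Nat.cast_nonneg N) _
    _ = P * ∑ m ∈ range K, geomBound N ((h : ℝ) * m / K) :=
        sum_range_mul_of_periodic (P := K) (g := P) (h := fun m => geomBound N ((h : ℝ) * m / K)) hper
    _ ≤ P * (2 * (Nat.gcd h K) * N + K * (1 + Real.log K)) := by
        gcongr
        have := sum_range_geomBound_progression_le hK h 0 (Nat.cast_nonneg N)
        simpa using this

/-- **The exponential sum over the box**: for `h ∈ ℕ`,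
`‖∑_{(m,n) ∈ [M₀,M₁)×[N₀,N₀+N)} e(h(mn + c)/K)‖ ≤ (M₁/K + 1)(2 gcd(h,K) N + K(1 + log K))`.
[cite: MauduitRivat2015, Lemma 9 (proof, last display p. 2604)] -/
theorem norm_sum_box_fourierChar_le {K : ℕ} (hK : 0 < K) (h c M₀ M₁ N₀ N : ℕ) :
    ‖∑ p ∈ (Ico M₀ M₁) ×ˢ (Ico N₀ (N₀ + N)), (𝐞 ((h : ℝ) * ((p.1 * p.2 + c : ℕ) : ℝ) / K) : ℂ)‖ ≤
      ((M₁ / K + 1 : ℕ) : ℝ) * (2 * (Nat.gcd h K) * N + K * (1 + Real.log K)) := by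
  rw [sum_product]
  calc ‖∑ m ∈ Ico M₀ M₁, ∑ n ∈ Ico N₀ (N₀ + N), (𝐞 ((h : ℝ) * ((m * n + c : ℕ) : ℝ) / K) : ℂ)‖
      ≤ ∑ m ∈ Ico M₀ M₁, ‖∑ n ∈ Ico N₀ (N₀ + N), (𝐞 ((h : ℝ) * ((m * n + c : ℕ) : ℝ) / K) : ℂ)‖ :=
        norm_sum_le _ _
    _ ≤ ∑ m ∈ Ico M₀ M₁, geomBound N ((h : ℝ) * m / K) := by
        refine sum_le_sum fun m _ => ?_
        have e : ∑ n ∈ Ico N₀ (N₀ + N), (𝐞 ((h : ℝ) * ((m * n + c : ℕ) : ℝ) / K) : ℂ) =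
            (𝐞 ((h : ℝ) * c / K) : ℂ) * ∑ n ∈ Ico N₀ (N₀ + N), (𝐞 ((n : ℝ) * ((h : ℝ) * m / K)) : ℂ) := by
          rw [mul_sum]
          refine sum_congr rfl fun n _ => ?_
          rw [coe_fourierChar_mul]
          congr 1; push_cast; ring
        rw [e, norm_mul, norm_fourierChar, one_mul]
        exact norm_sum_Ico_fourierChar_le_geomBound N₀ N _
    _ ≤ _ := sum_Ico_geomBound_mul_div_le hK h M₀ M₁ N

/-- The trivial bound `‖∑_{box} e(·)‖ ≤ (M₁ − M₀) N`. [folklore] -/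
theorem norm_sum_box_fourierChar_le_card (K : ℕ) (t : ℝ) (c M₀ M₁ N₀ N : ℕ) :
    ‖∑ p ∈ (Ico M₀ M₁) ×ˢ (Ico N₀ (N₀ + N)), (𝐞 (t * ((p.1 * p.2 + c : ℕ) : ℝ) / K) : ℂ)‖ ≤
      ((M₁ - M₀ : ℕ) : ℝ) * N := by
  calc ‖∑ p ∈ (Ico M₀ M₁) ×ˢ (Ico N₀ (N₀ + N)), (𝐞 (t * ((p.1 * p.2 + c : ℕ) : ℝ) / K) : ℂ)‖
      ≤ ∑ p ∈ (Ico M₀ M₁) ×ˢ (Ico N₀ (N₀ + N)), ‖(𝐞 (t * ((p.1 * p.2 + c : ℕ) : ℝ) / K) : ℂ)‖ :=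
        norm_sum_le _ _
    _ = ((M₁ - M₀ : ℕ) : ℝ) * N := by
        simp only [norm_fourierChar, sum_const, card_product, Nat.card_Ico, Nat.add_sub_cancel_left,
          nsmul_eq_mul, mul_one, Nat.cast_mul]

/-! ## Harmonic sums of gcd's -/

/-- `∑_{0<h<K} gcd(h,K)/h ≤ τ(K)(1 + log K)`: `gcd(h,K) ≤ ∑_{d ∣ K, d ∣ h} d` and
`∑_{h<K, d∣h} d/h ≤ 1 + log K`. [folklore] -/
theorem sum_Ico_gcd_div_le {K : ℕ} (hK : 0 < K) :
    ∑ h ∈ Ico 1 K, (Nat.gcd h K : ℝ) / h ≤ (K.divisors.card : ℝ) * (1 + Real.log K) := by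
  have hKR : (0 : ℝ) < K := by exact_mod_cast hK
  -- pointwise: gcd(h,K) ≤ ∑_{d ∣ K, d ∣ h} d
  have key : ∀ h ∈ Ico 1 K, (Nat.gcd h K : ℝ) / h ≤
      ∑ d ∈ K.divisors, if d ∣ h then (d : ℝ) / h else 0 := by
    intro h hh
    have hh1 : 0 < h := (mem_Ico.1 hh).1
    have hmem : Nat.gcd h K ∈ K.divisors := Nat.mem_divisors.2 ⟨Nat.gcd_dvd_right h K, hK.ne'⟩
    calc (Nat.gcd h K : ℝ) / h = ∑ d ∈ K.divisors, if d = Nat.gcd h K then (d : ℝ) / h else 0 := by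
          rw [sum_ite_eq' K.divisors (Nat.gcd h K) (fun d => (d : ℝ) / h), if_pos hmem]
      _ ≤ ∑ d ∈ K.divisors, if d ∣ h then (d : ℝ) / h else 0 := by
          refine sum_le_sum fun d _ => ?_
          split_ifs with h1 h2 h2
          · exact le_rfl
          · exact absurd (h1 ▸ Nat.gcd_dvd_left h K) h2
          · positivity
          · exact le_rfl
  refine (sum_le_sum key).trans ?_
  rw [sum_comm]
  have hlogK : 0 ≤ 1 + Real.log K := by
    have := Real.log_nonneg (show (1 : ℝ) ≤ K by exact_mod_cast hK); linarith
  calc ∑ d ∈ K.divisors, ∑ h ∈ Ico 1 K, (if d ∣ h then (d : ℝ) / h else 0)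
      ≤ ∑ d ∈ K.divisors, (1 + Real.log K) := by
        refine sum_le_sum fun d hd => ?_
        have hd0 : 0 < d := Nat.pos_of_mem_divisors hd
        have hdR : (0 : ℝ) < d := by exact_mod_cast hd0
        rw [← sum_filter]
        -- the multiples of `d` in `[1, K)` are `d j`, `1 ≤ j ≤ K/d`
        calc ∑ h ∈ (Ico 1 K).filter (fun h => d ∣ h), (d : ℝ) / h
            ≤ ∑ h ∈ (Icc 1 (K / d)).image (fun j => d * j), (d : ℝ) / h := by
              refine sum_le_sum_of_subset_of_nonneg (fun h hh => ?_) (fun _ _ _ => by positivity)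
              rw [mem_filter, mem_Ico] at hh
              obtain ⟨⟨h1, h2⟩, j, rfl⟩ := hh
              refine mem_image.2 ⟨j, mem_Icc.2 ⟨?_, ?_⟩, rfl⟩
              · rcases Nat.eq_zero_or_pos j with h0 | h0
                · rw [h0, mul_zero] at h1; omega
                · exact h0
              · rw [Nat.le_div_iff_mul_le hd0, mul_comm]; exact h2.le
          _ = ∑ j ∈ Icc 1 (K / d), (d : ℝ) / ((d * j : ℕ) : ℝ) := by
              rw [sum_image]
              intro j _ j' _ hjj
              exact Nat.eq_of_mul_eq_mul_left hd0 hjj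
          _ = ∑ j ∈ Icc 1 (K / d), (1 : ℝ) / j := by
              refine sum_congr rfl fun j hj => ?_
              have hj0 : (0 : ℝ) < j := by exact_mod_cast (mem_Icc.1 hj).1
              push_cast
              field_simp
          _ = (harmonic (K / d) : ℝ) := by
              rw [harmonic_eq_sum_Icc]; push_cast
              exact sum_congr rfl fun j _ => by rw [one_div]
          _ ≤ 1 + Real.log ((K / d : ℕ) : ℝ) := harmonic_le_one_add_log _
          _ ≤ 1 + Real.log K := by
              have hKd : 1 ≤ K / d := (Nat.le_div_iff_mul_le hd0).2 (by
                rw [one_mul]; exact Nat.le_of_dvd hK (Nat.dvd_of_mem_divisors hd))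
              have h1 : Real.log ((K / d : ℕ) : ℝ) ≤ Real.log K :=
                Real.log_le_log (by exact_mod_cast hKd) (by exact_mod_cast Nat.div_le_self K d)
              linarith
    _ = (K.divisors.card : ℝ) * (1 + Real.log K) := by rw [sum_const, nsmul_eq_mul]

/-- `min(L, 1/(2‖h/K‖)) ≤ K/(2h) + K/(2(K − h))` for `0 < h < K`. [folklore] -/
theorem geomBound_div_le_add {K h : ℕ} (hh : 0 < h) (hhK : h < K) (L : ℝ) :
    geomBound L ((h : ℝ) / K) ≤ (K : ℝ) / (2 * h) + (K : ℝ) / (2 * ((K : ℝ) - h)) := by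
  have hK : 0 < K := lt_of_le_of_lt (Nat.zero_le _) hhK
  have hKR : (0 : ℝ) < K := by exact_mod_cast hK
  have hhR : (0 : ℝ) < h := by exact_mod_cast hh
  have hKh : (0 : ℝ) < (K : ℝ) - h := by
    have : (h : ℝ) < K := by exact_mod_cast hhK
    linarith
  have hmin : min (h : ℝ) ((K : ℝ) - h) / K ≤ distInt ((h : ℝ) / K) := min_div_le_distInt hK hhK.le
  have hminpos : 0 < min (h : ℝ) ((K : ℝ) - h) := lt_min hhR hKh
  have hd : 0 < distInt ((h : ℝ) / K) := lt_of_lt_of_le (by positivity) hmin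
  calc geomBound L ((h : ℝ) / K) ≤ 1 / (2 * distInt ((h : ℝ) / K)) := geomBound_le_inv L hd
    _ ≤ 1 / (2 * (min (h : ℝ) ((K : ℝ) - h) / K)) := by
        apply one_div_le_one_div_of_le (by positivity)
        linarith
    _ = (K : ℝ) / (2 * min (h : ℝ) ((K : ℝ) - h)) := by
        field_simp
    _ ≤ (K : ℝ) / (2 * h) + (K : ℝ) / (2 * ((K : ℝ) - h)) := by
        rcases le_total (h : ℝ) ((K : ℝ) - h) with h1 | h1
        · rw [min_eq_left h1]
          have : 0 ≤ (K : ℝ) / (2 * ((K : ℝ) - h)) := by positivity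
          linarith
        · rw [min_eq_right h1]
          have : 0 ≤ (K : ℝ) / (2 * h) := by positivity
          linarith

/-- **`∑_{0<h<K} min(L, 1/(2‖h/K‖)) gcd(h,K) ≤ K τ(K)(1 + log K)`** (pair `h` with `K − h`).
[folklore] -/
theorem sum_Ico_geomBound_gcd_le {K : ℕ} (hK : 0 < K) (L : ℝ) :
    ∑ h ∈ Ico 1 K, geomBound L ((h : ℝ) / K) * (Nat.gcd h K : ℝ) ≤
      (K : ℝ) * ((K.divisors.card : ℝ) * (1 + Real.log K)) := by
  have hKR : (0 : ℝ) < K := by exact_mod_cast hK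
  -- pointwise
  have h1 : ∑ h ∈ Ico 1 K, geomBound L ((h : ℝ) / K) * (Nat.gcd h K : ℝ) ≤
      ∑ h ∈ Ico 1 K, ((K : ℝ) / 2 * ((Nat.gcd h K : ℝ) / h) +
        (K : ℝ) / 2 * ((Nat.gcd (K - h) K : ℝ) / ((K - h : ℕ) : ℝ))) := by
    refine sum_le_sum fun h hh => ?_
    rw [mem_Ico] at hh
    have hg : Nat.gcd (K - h) K = Nat.gcd h K := Nat.gcd_self_sub_left hh.2.le
    rw [hg, Nat.cast_sub hh.2.le]
    have hb := geomBound_div_le_add hh.1 hh.2 L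
    have hg0 : 0 ≤ (Nat.gcd h K : ℝ) := Nat.cast_nonneg _
    have hhR : (0 : ℝ) < h := by exact_mod_cast hh.1
    have hKh : (0 : ℝ) < (K : ℝ) - h := by
      have : (h : ℝ) < K := by exact_mod_cast hh.2
      linarith
    calc geomBound L ((h : ℝ) / K) * (Nat.gcd h K : ℝ)
        ≤ ((K : ℝ) / (2 * h) + (K : ℝ) / (2 * ((K : ℝ) - h))) * (Nat.gcd h K : ℝ) :=
          mul_le_mul_of_nonneg_right hb hg0
      _ = (K : ℝ) / 2 * ((Nat.gcd h K : ℝ) / h) + (K : ℝ) / 2 * ((Nat.gcd h K : ℝ) / ((K : ℝ) - h)) := by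
          field_simp
  refine h1.trans ?_
  rw [sum_add_distrib, ← mul_sum, ← mul_sum]
  -- reflect the second sum
  have hrefl : ∑ h ∈ Ico 1 K, (Nat.gcd (K - h) K : ℝ) / ((K - h : ℕ) : ℝ) =
      ∑ h ∈ Ico 1 K, (Nat.gcd h K : ℝ) / h := by
    have h := sum_Ico_reflect (fun j => (Nat.gcd j K : ℝ) / j) 1 (show K ≤ K + 1 by omega)
    rw [Nat.add_sub_cancel_left, Nat.add_sub_cancel] at h
    exact h
  rw [hrefl, ← mul_add, ← two_mul]
  have hs := sum_Ico_gcd_div_le hK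
  have h0 : 0 ≤ ∑ h ∈ Ico 1 K, (Nat.gcd h K : ℝ) / h := sum_nonneg fun h _ => by positivity
  calc (K : ℝ) / 2 * (2 * ∑ h ∈ Ico 1 K, (Nat.gcd h K : ℝ) / h)
      = K * ∑ h ∈ Ico 1 K, (Nat.gcd h K : ℝ) / h := by ring
    _ ≤ (K : ℝ) * ((K.divisors.card : ℝ) * (1 + Real.log K)) :=
        mul_le_mul_of_nonneg_left hs hKR.le

/-! ## The smoothed count -/

/-- **The sum of the smoothed block indicators over the box** (Fourier expansion, `h = 0` exactly,
`h ≠ 0` by `norm_sum_box_fourierChar_le`): for `K = K'L ≥ 1`, `B ⊆ [0,K')`,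
`∑_{(m,n)} ∑_{u∈B} A_u(mn+c) ≤ (L/K) #B (M₁−M₀) N + 2 #B (M₁/K+1)(1 + log K)(2Nτ(K) + 2L + K(1 + log K))`.
[cite: MauduitRivat2015, Lemma 9 (proof, pp. 2604–2605)] -/
theorem sum_box_sum_smoothInd_le {K K' L : ℕ} (hK : K = K' * L) (hKpos : 0 < K)
    {B : Finset ℕ} (hB : ∀ u ∈ B, u < K') (c M₀ M₁ N₀ N : ℕ) :
    ∑ p ∈ (Ico M₀ M₁) ×ˢ (Ico N₀ (N₀ + N)), ∑ u ∈ B, smoothInd K L K u (p.1 * p.2 + c) ≤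
      (L : ℝ) / K * B.card * ((M₁ - M₀ : ℕ) : ℝ) * N +
        2 * B.card * ((M₁ / K + 1 : ℕ) : ℝ) * (1 + Real.log K) *
          (2 * N * (K.divisors.card : ℝ) + 2 * L + K * (1 + Real.log K)) := by
  have hKR : (0 : ℝ) < K := by exact_mod_cast hKpos
  have hK1 : 1 ≤ K := hKpos
  set box := (Ico M₀ M₁) ×ˢ (Ico N₀ (N₀ + N)) with hbox
  set Ssm := ∑ p ∈ box, ∑ u ∈ B, smoothInd K L K u (p.1 * p.2 + c) with hSsm
  -- the character sums
  set Bs : ℤ → ℂ := fun h => ∑ u ∈ B, (𝐞 (-((h : ℝ) * u / K')) : ℂ) with hBs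
  set Cs : ℤ → ℂ := fun h => ∑ p ∈ box, (𝐞 ((h : ℝ) * ((p.1 * p.2 + c : ℕ) : ℝ) / K) : ℂ) with hCs
  -- (1) the Fourier expansion of `Ssm`
  have hexp : ((Ssm : ℝ) : ℂ) = ∑ h ∈ Ioo (-(K : ℤ)) K, ahat K L K h * Bs h * Cs h := by
    have h1 : ((Ssm : ℝ) : ℂ) = ∑ p ∈ box, ∑ u ∈ B, ∑ h ∈ Ioo (-(K : ℤ)) K,
        ahat K L K h * ((𝐞 (-((h : ℝ) * u / K')) : ℂ) * (𝐞 ((h : ℝ) * ((p.1 * p.2 + c : ℕ) : ℝ) / K) : ℂ)) := by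
      rw [hSsm, Complex.ofReal_sum]
      refine sum_congr rfl fun p _ => ?_
      rw [Complex.ofReal_sum]
      refine sum_congr rfl fun u hu => ?_
      exact smoothInd_eq_sum_ahat hK hKpos (hB u hu) _
    rw [h1, sum_rotate3, sum_rotate3]
    refine sum_congr rfl fun h _ => ?_
    rw [hBs, hCs]
    simp only
    rw [mul_assoc, sum_mul_sum, mul_sum, sum_comm]
    refine sum_congr rfl fun p _ => ?_
    rw [mul_sum]
  -- (2) norms of the character sums
  have hBs_le : ∀ h : ℤ, ‖Bs h‖ ≤ B.card := by
    intro h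
    rw [hBs]
    calc ‖∑ u ∈ B, (𝐞 (-((h : ℝ) * u / K')) : ℂ)‖ ≤ ∑ u ∈ B, ‖(𝐞 (-((h : ℝ) * u / K')) : ℂ)‖ :=
          norm_sum_le _ _
      _ = B.card := by simp only [norm_fourierChar, sum_const, nsmul_eq_mul, mul_one]
  have hCs0 : ‖Cs 0‖ ≤ ((M₁ - M₀ : ℕ) : ℝ) * N := by
    have := norm_sum_box_fourierChar_le_card K ((0 : ℤ) : ℝ) c M₀ M₁ N₀ N
    rw [hCs]
    exact this
  have hCs_nat : ∀ h : ℕ, ‖Cs (h : ℤ)‖ ≤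
      ((M₁ / K + 1 : ℕ) : ℝ) * (2 * (Nat.gcd h K) * N + K * (1 + Real.log K)) := by
    intro h
    have := norm_sum_box_fourierChar_le hKpos h c M₀ M₁ N₀ N
    rw [hCs]
    simp only [Int.cast_natCast]
    exact this
  have hCs_neg : ∀ h : ℤ, ‖Cs (-h)‖ = ‖Cs h‖ := by
    intro h
    rw [hCs]
    simp only
    have e : ∑ p ∈ box, (𝐞 ((((-h : ℤ) : ℝ)) * ((p.1 * p.2 + c : ℕ) : ℝ) / K) : ℂ) =
        conj (∑ p ∈ box, (𝐞 ((h : ℝ) * ((p.1 * p.2 + c : ℕ) : ℝ) / K) : ℂ)) := by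
      rw [map_sum]
      refine sum_congr rfl fun p _ => ?_
      rw [conj_coe_fourierChar]
      congr 2
      push_cast; ring
    rw [e, RCLike.norm_conj]
  have hahat : ∀ h : ℤ, ‖ahat K L K h‖ ≤ (K : ℝ)⁻¹ * geomBound L ((h : ℝ) / K) :=
    fun h => norm_ahat_le hKpos L K h
  -- (3) bound `Ssm` by the sum of the norms, split `h = 0` / `h ≠ 0`
  set F : ℤ → ℝ := fun h => ‖ahat K L K h‖ * B.card * ‖Cs h‖ with hF
  have hF0 : ∀ h, 0 ≤ F h := fun h => by rw [hF]; positivity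
  have hSF : Ssm ≤ ∑ h ∈ Ioo (-(K : ℤ)) K, F h := by
    calc Ssm ≤ ‖((Ssm : ℝ) : ℂ)‖ := by
          rw [Complex.norm_real, Real.norm_eq_abs]; exact le_abs_self _
      _ = ‖∑ h ∈ Ioo (-(K : ℤ)) K, ahat K L K h * Bs h * Cs h‖ := by rw [hexp]
      _ ≤ ∑ h ∈ Ioo (-(K : ℤ)) K, ‖ahat K L K h * Bs h * Cs h‖ := norm_sum_le _ _
      _ ≤ ∑ h ∈ Ioo (-(K : ℤ)) K, F h := by
          refine sum_le_sum fun h _ => ?_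
          simp only [hF]
          rw [norm_mul, norm_mul]
          gcongr
          exact hBs_le h
  refine hSF.trans ?_
  rw [sum_Ioo_neg_eq F hK1]
  -- the term `h = 0`
  have hmain : F 0 ≤ (L : ℝ) / K * B.card * ((M₁ - M₀ : ℕ) : ℝ) * N := by
    simp only [hF]
    have h0 : ‖ahat K L K 0‖ ≤ (L : ℝ) / K := by
      have := hahat 0
      rw [Int.cast_zero, zero_div, geomBound_zero] at this
      rw [div_eq_inv_mul]; exact this
    calc ‖ahat K L K 0‖ * B.card * ‖Cs 0‖ ≤ (L : ℝ) / K * B.card * (((M₁ - M₀ : ℕ) : ℝ) * N) := by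
          gcongr
      _ = _ := by ring
  -- the terms `h ≠ 0`
  have hside : ∀ h ∈ Ico 1 K, F (h : ℤ) + F (-(h : ℤ)) ≤
      2 * ((K : ℝ)⁻¹ * geomBound L ((h : ℝ) / K)) * B.card *
        (((M₁ / K + 1 : ℕ) : ℝ) * (2 * (Nat.gcd h K) * N + K * (1 + Real.log K))) := by
    intro h _
    have hg0 : 0 ≤ (K : ℝ)⁻¹ * geomBound L ((h : ℝ) / K) * B.card :=
      mul_nonneg (mul_nonneg (by positivity) (geomBound_nonneg (Nat.cast_nonneg L) _)) (Nat.cast_nonneg _)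
    have ha1 : ‖ahat K L K (h : ℤ)‖ ≤ (K : ℝ)⁻¹ * geomBound L ((h : ℝ) / K) := by
      have := hahat h; rwa [Int.cast_natCast] at this
    have ha2 : ‖ahat K L K (-(h : ℤ))‖ ≤ (K : ℝ)⁻¹ * geomBound L ((h : ℝ) / K) := by
      have := hahat (-(h : ℤ))
      rwa [Int.cast_neg, Int.cast_natCast, neg_div, geomBound_neg] at this
    have hc2 : ‖Cs (-(h : ℤ))‖ ≤
        ((M₁ / K + 1 : ℕ) : ℝ) * (2 * (Nat.gcd h K) * N + K * (1 + Real.log K)) := by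
      rw [hCs_neg]; exact hCs_nat h
    have e1 : F (h : ℤ) ≤ ((K : ℝ)⁻¹ * geomBound L ((h : ℝ) / K)) * B.card *
        (((M₁ / K + 1 : ℕ) : ℝ) * (2 * (Nat.gcd h K) * N + K * (1 + Real.log K))) := by
      simp only [hF]
      exact mul_le_mul (mul_le_mul_of_nonneg_right ha1 (Nat.cast_nonneg _)) (hCs_nat h)
        (norm_nonneg _) hg0
    have e2 : F (-(h : ℤ)) ≤ ((K : ℝ)⁻¹ * geomBound L ((h : ℝ) / K)) * B.card *
        (((M₁ / K + 1 : ℕ) : ℝ) * (2 * (Nat.gcd h K) * N + K * (1 + Real.log K))) := by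
      simp only [hF]
      exact mul_le_mul (mul_le_mul_of_nonneg_right ha2 (Nat.cast_nonneg _)) hc2
        (norm_nonneg _) hg0
    linarith
  have hlogK : 0 ≤ 1 + Real.log K := by
    have := Real.log_nonneg (show (1 : ℝ) ≤ K by exact_mod_cast hK1); linarith
  have hsum2 : ∑ h ∈ Ico 1 K, geomBound L ((h : ℝ) / K) ≤ 2 * L + K * (1 + Real.log K) := by
    calc ∑ h ∈ Ico 1 K, geomBound L ((h : ℝ) / K) ≤ ∑ h ∈ range K, geomBound L ((h : ℝ) / K) := by
          refine sum_le_sum_of_subset_of_nonneg (fun h hh => ?_) (fun h _ _ => geomBound_nonneg (Nat.cast_nonneg L) _)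
          rw [mem_Ico] at hh; exact mem_range.2 hh.2
      _ ≤ 2 * L + K * (1 + Real.log K) := by
          have := sum_range_geomBound_div_add_le hKpos (Nat.cast_nonneg L) 0
          simpa using this
  have hsum1 := sum_Ico_geomBound_gcd_le hKpos (L : ℝ)
  set P : ℝ := ((M₁ / K + 1 : ℕ) : ℝ) with hP
  calc F 0 + ∑ h ∈ Ico 1 K, (F (h : ℤ) + F (-(h : ℤ)))
      ≤ (L : ℝ) / K * B.card * ((M₁ - M₀ : ℕ) : ℝ) * N +
          ∑ h ∈ Ico 1 K, 2 * ((K : ℝ)⁻¹ * geomBound L ((h : ℝ) / K)) * B.card *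
            (P * (2 * (Nat.gcd h K) * N + K * (1 + Real.log K))) := add_le_add hmain (sum_le_sum hside)
    _ = (L : ℝ) / K * B.card * ((M₁ - M₀ : ℕ) : ℝ) * N +
          2 * B.card * P * (K : ℝ)⁻¹ *
            (2 * N * ∑ h ∈ Ico 1 K, geomBound L ((h : ℝ) / K) * (Nat.gcd h K : ℝ) +
              K * (1 + Real.log K) * ∑ h ∈ Ico 1 K, geomBound L ((h : ℝ) / K)) := by
        congr 1
        have e : ∀ h ∈ Ico 1 K, 2 * ((K : ℝ)⁻¹ * geomBound L ((h : ℝ) / K)) * B.card *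
            (P * (2 * (Nat.gcd h K) * N + K * (1 + Real.log K))) =
            (2 * B.card * P * (K : ℝ)⁻¹ * (2 * N)) * (geomBound L ((h : ℝ) / K) * (Nat.gcd h K : ℝ)) +
              (2 * B.card * P * (K : ℝ)⁻¹ * (K * (1 + Real.log K))) * geomBound L ((h : ℝ) / K) := by
          intro h _; ring
        rw [sum_congr rfl e, sum_add_distrib, ← mul_sum, ← mul_sum]
        ring
    _ ≤ (L : ℝ) / K * B.card * ((M₁ - M₀ : ℕ) : ℝ) * N +
          2 * B.card * P * (K : ℝ)⁻¹ *
            (2 * N * ((K : ℝ) * ((K.divisors.card : ℝ) * (1 + Real.log K))) +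
              K * (1 + Real.log K) * (2 * L + K * (1 + Real.log K))) := by
        gcongr
    _ = _ := by
        field_simp
        ring

/-! ## The sharp count -/

/-- **Sharp count of products in residue blocks** (Mauduit–Rivat's Lemma 9 by exponential sums, discrete
form): for `K = K'L ≥ 1`, `B ⊆ [0, K')`, `M₀ ≥ 1`, the pairs `(m,n) ∈ [M₀,M₁) × [N₀,N₀+N)` with
`⌊((mn + c) mod K)/L⌋ ∈ B` number at most
`2 #B (L/K)(M₁−M₀)N + 4 #B (M₁/K + 1)(1 + log K)(2Nτ(K) + 2L + K(1 + log K)) + 2(M₁−M₀)(N/L + 3) + 8τ(L)M₁N/L`.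
[cite: MauduitRivat2015, Lemma 9] -/
theorem card_box_block_mem_le_sharp {K K' L : ℕ} (hK : K = K' * L) (hL : 0 < L) (hKpos : 0 < K)
    {B : Finset ℕ} (hB : ∀ u ∈ B, u < K') (c : ℕ) {M₀ M₁ : ℕ} (hM₀ : 1 ≤ M₀) (N₀ N : ℕ) :
    ((((Ico M₀ M₁) ×ˢ (Ico N₀ (N₀ + N))).filter
        (fun p : ℕ × ℕ => (p.1 * p.2 + c) % K / L ∈ B)).card : ℝ) ≤
      2 * ((L : ℝ) / K * B.card * ((M₁ - M₀ : ℕ) : ℝ) * N) +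
        4 * B.card * ((M₁ / K + 1 : ℕ) : ℝ) * (1 + Real.log K) *
          (2 * N * (K.divisors.card : ℝ) + 2 * L + K * (1 + Real.log K)) +
        (2 * ((M₁ - M₀ : ℕ) : ℝ) * ((N : ℝ) / L + 3) + 8 * (L.divisors.card : ℝ) * M₁ * N / L) := by
  set box := (Ico M₀ M₁) ×ˢ (Ico N₀ (N₀ + N)) with hbox
  -- pointwise majorant summed over the box
  have h1 : ((box.filter (fun p : ℕ × ℕ => (p.1 * p.2 + c) % K / L ∈ B)).card : ℝ) ≤
      2 * ∑ p ∈ box, ∑ u ∈ B, smoothInd K L K u (p.1 * p.2 + c) +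
        ((box.filter (fun p : ℕ × ℕ => gridDist L (p.1 * p.2 + c) ≤ 1)).card : ℝ) := by
    rw [natCast_card_filter, natCast_card_filter, mul_sum, ← sum_add_distrib]
    exact sum_le_sum fun p _ => indicator_block_le_smoothInd hK hL hKpos B _
  have h2 := sum_box_sum_smoothInd_le hK hKpos hB c M₀ M₁ N₀ N
  have h3 := card_box_gridDist_le hL 1 c hM₀ N₀ N (M₁ := M₁)
  have h3' : ((box.filter (fun p : ℕ × ℕ => gridDist L (p.1 * p.2 + c) ≤ 1)).card : ℝ) ≤
      2 * ((M₁ - M₀ : ℕ) : ℝ) * ((N : ℝ) / L + 3) + 8 * (L.divisors.card : ℝ) * M₁ * N / L := by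
    refine h3.trans (le_of_eq ?_)
    push_cast; ring
  linarith

/-- **Sharp form of Lemma 9 / Müllner's Lemma 5.3 (counting)**, base `k`: the pairs
`(m, n) ∈ [M₀, M₁) × [N₀, N₀+N)` with `r_{μ₀,μ₂}(mn + c) ∈ B` number at most
`2 #B (M₁−M₀) N k^{μ₀}/k^{μ₂} + 4 #B (M₁/k^{μ₂} + 1)(1 + log k^{μ₂})(2Nτ(k^{μ₂}) + 2k^{μ₀} + k^{μ₂}(1 + log k^{μ₂}))`
`+ 2(M₁−M₀)(N/k^{μ₀} + 3) + 8τ(k^{μ₀})M₁N/k^{μ₀}` (`k ≥ 1`, `μ₀ ≤ μ₂`, `M₀ ≥ 1`,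
`B ⊆ [0, k^{μ₂−μ₀})`). [cite: MauduitRivat2015, Lemma 9] [cite: Mullner2017, Lemma 5.3] -/
theorem card_box_midDigit_mem_le_sharp {k : ℕ} (hk : 0 < k) {μ₀ μ₂ : ℕ} (hμ : μ₀ ≤ μ₂)
    {B : Finset ℕ} (hB : ∀ u ∈ B, u < k ^ (μ₂ - μ₀)) (c : ℕ) {M₀ M₁ : ℕ} (hM₀ : 1 ≤ M₀)
    (N₀ N : ℕ) :
    ((((Ico M₀ M₁) ×ˢ (Ico N₀ (N₀ + N))).filter
        (fun p : ℕ × ℕ => midDigit k μ₀ μ₂ (p.1 * p.2 + c) ∈ B)).card : ℝ) ≤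
      2 * (((k ^ μ₀ : ℕ) : ℝ) / (k ^ μ₂ : ℕ) * B.card * ((M₁ - M₀ : ℕ) : ℝ) * N) +
        4 * B.card * ((M₁ / k ^ μ₂ + 1 : ℕ) : ℝ) * (1 + Real.log ((k ^ μ₂ : ℕ) : ℝ)) *
          (2 * N * ((k ^ μ₂).divisors.card : ℝ) + 2 * (k ^ μ₀ : ℕ) +
            (k ^ μ₂ : ℕ) * (1 + Real.log ((k ^ μ₂ : ℕ) : ℝ))) +
        (2 * ((M₁ - M₀ : ℕ) : ℝ) * ((N : ℝ) / (k ^ μ₀ : ℕ) + 3) +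
          8 * ((k ^ μ₀).divisors.card : ℝ) * M₁ * N / (k ^ μ₀ : ℕ)) := by
  have hK : k ^ μ₂ = k ^ (μ₂ - μ₀) * k ^ μ₀ := by rw [← pow_add, Nat.sub_add_cancel hμ]
  have h := card_box_block_mem_le_sharp hK (pow_pos hk _) (pow_pos hk _) hB c hM₀ N₀ N (M₁ := M₁)
  simp only [midDigit_apply]
  exact h

end Literature.NumberTheory.LFunctions.MauduitRivat
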